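import Summits.QuantumFields.BalabanUV.Beta.MultiscaleHessianGeometry
import Summits.QuantumFields.BalabanUV.Beta.MultiscaleGradientL2

/-!
# `Summit.QuantumFields.BalabanUV.Beta.MultiscaleHessianCells` — engine file 22e: THE THREE CELLWISE INPUTS OF THE HESSIAN MEMBER ON A NEAR
# CELL, IN ONE CURRENCY — for `w = (levelOp)⁻¹u` (`u` supported in cell `k′`) and a cell `k″` with `d_n(t_{k″},t_k) ≤ 4d + ρ₀`:
# `Σ_{cell k″} w² ≤ K_w·S_k⁴·E²‖u‖²` (file 8), `Σ_{cell k″-bonds}(Dw)² ≤ K_∇·S_k²·E²‖u‖²` (file 20c), `Σ_{cell k″}(D*Dw)² ≤ K_Δ·E²‖u‖²`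
# (`D*Dw = u − Σ_l a_lG_lᵀG_l w` + file 10a), with the COMMON decay factor `E = e^{(κ−log L/R)(4d+ρ₀)}·e^{−(κ−log L/R)d_n(t_k,t_{k′})}` and
# the TARGET cell's side `S_k` (two-sided scale comparison of file 22d) — programme «HESSIAN-L2-FLAT», consumed by file 22f

HONEST FRAMING (page 1 of everything in this cell).  Discharging `FlowStep.BetaPertH` would make Bałaban's ultraviolet
stability UNCONDITIONAL — a constructive-QFT result; it is NOT the continuum limit and NOT the Clay problem.  This module
discharges nothing of `BetaPertH`; it is [folklore] finite-dimensional bookkeeping about the MODEL operator, kernel-checked, by the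
OWNER of binder row D4 (unit `b2b-balaban-beta-an4`, gen 47).  HONEST DEPENDENCY: continuum YM on T⁴ ⇐ BetaPertH ∧ nine spine
estimates (0/9 proved); BetaPertH ⇐ (D1) ∧ (D4) ∧ CAP+tail; G-an2-4 gates asym, D1 and NE2/3/4.

THE POINT (O.2 item (i), MODEL level; NOT the critical path).  File 22c bounds the Hessian energy of `w` on cell `k` by `‖D*Dw‖²`,
`S_k^{−4}‖w‖²`, `S_k^{−2}‖Dw‖²` on a box, and file 22d covers that box by the NEAR cells `k″` (`d_n(t_{k″},t_k) ≤ 4d + ρ₀`), whose sides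
are within `Γ₄ = L^A e^{(log L/R)(4d+ρ₀)}` of `S_k`.  On each near cell the three quantities are controlled by landed members, EVERY
isometric transport: (3.46)₁ in its graded target-scale form (file 8 `real_cellNorm_levelOp_inverse_le_graded`: `S_{k″}²`), (3.46)₂ graded
(file 20c `real_cellGrad_levelOp_inverse_le_graded`: `S_{k″}`), and `D*Dw = levelOp w − (Σ_l a_lG_lᵀG_l)w = u − (…)w` with file 10a's
pointwise averaging budget `|(Σ_l a_lG_lᵀG_l w)(p)| ≤ a_max S_{k″}^{−2}√(S_{k″}^{−d}Σ_{cell k″}w²)` summed over the `≤ S_{k″}^d|Cp|` points of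
the cell — where the `S_{k″}^{−4}` EXACTLY cancels the `S_{k″}⁴` of (3.46)₁: the Laplacian piece is scale-free, as print's prefactor «1»
demands.  The decay `e^{−κ₁d_n(t_{k″},t_{k′})}` of each member is moved to the target cell (`exp_decay_transfer`), and `S_{k″}` to `S_k`
(`scale_cmp_of_near`).  THIS FILE: the three bounds `cell_sq_norm_le_near`, `cell_sq_grad_le_near`, `cell_sq_lap_le_near`.

WHAT IS CERTIFIED (kernel, 0 sorry, 0 def): the three theorems + `covLap_eq_sub_levelSum` (`D*D(levelOp)⁻¹u = u − (Σa_lG_lᵀG_l)(levelOp)⁻¹u`)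
+ `cell_sq_levelSum_le` (the ℓ²-cell form of 10a).  LOCATORS (shape only; ABSOLUTE RULE — nothing printed is asserted):
[Balaban1985BackgroundPropagators] Thm 3.1 (3.46) p. 398, (3.16) p. 393, (3.24) p. 394; [Balaban1984PropagatorsII] (2.1)–(2.2) p. 224.
NOT BetaPertH, NOT continuum, NOT Clay, NOT summit progress.
-/

open scoped BigOperators
open Finset

namespace Summit.QuantumFields.BalabanUV.Beta.MultiscaleHessianCells

open Summit.QuantumFields.BalabanUV.Beta.MultiscaleHessianGeometry (scale_cmp_of_near exp_decay_transfer)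
open Summit.QuantumFields.BalabanUV.Beta.MultiscaleCombesThomasL2CellsGraded (siteScale_ctrU real_cellNorm_levelOp_inverse_le_graded)
open Summit.QuantumFields.BalabanUV.Beta.MultiscaleGradientL2 (real_cellGrad_levelOp_inverse_le_graded)
open Summit.QuantumFields.BalabanUV.Beta.MultiscaleAveragingPointwise (abs_levelSum_apply_le)
open Summit.QuantumFields.BalabanUV.Beta.MultiscaleSupMemberBall (card_cellCp_le)
open Summit.QuantumFields.BalabanUV.Beta.BoxPoincare (Box)
open Summit.QuantumFields.BalabanUV.Beta.MultiscaleCoerciveTorus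
open Summit.QuantumFields.BalabanUV.Beta.MultiscaleDistance
open Summit.QuantumFields.BalabanUV.Beta.MultiscaleDistanceMetric (sdist_comm)
open Summit.QuantumFields.BalabanUV.Beta.MultiscaleDecayBudget
open Summit.QuantumFields.BalabanUV.Beta.MultiscaleDecay (decay_levelOp)
open Literature.MathematicalPhysics.QuantumFieldTheory.Balaban1983to89
open Literature.MathematicalPhysics.QuantumFieldTheory.Balaban1983to89.B9Thm37Glue (covD covDT)
open Literature.MathematicalPhysics.QuantumFieldTheory.Balaban1983to89.B9Thm37GluePU (bsrc btgt)
open Literature.MathematicalPhysics.QuantumFieldTheory.Balaban1983to89.B9Thm37GlueTorusCov (tblk)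
open Literature.MathematicalPhysics.QuantumFieldTheory.Balaban1983to89.B9Thm37GlueTorusCovLevels (levelOp levelSum)
open B5TorusCover (UT Ctr ctrU)

noncomputable section

variable {d : ℕ} {N : Fin d → ℕ} [∀ i, NeZero (N i)] [NeZero d] {Cp J K : Type} [Fintype Cp] [DecidableEq Cp] [Nonempty Cp]
  [Fintype J] [Fintype K] [DecidableEq K] (S : J → ℕ) (hS : ∀ l, 1 ≤ S l) (hdivS : ∀ l i, S l ∣ N i) (lvl : K → J)
  (zc : (k : K) → Ctr N (S (lvl k)))
  (hdisj : ∀ k k' v v', cellPt S hS hdivS lvl zc k v = cellPt S hS hdivS lvl zc k' v' → k = k')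
  (hcover : ∀ x : UT N, ∃ k, ∃ v : Box d (S (lvl k)), cellPt S hS hdivS lvl zc k v = x)
  (Rm : UT N × Fin d → Cp → Cp → ℝ) (hRm : ∀ b i j, ∑ k, Rm b k i * Rm b k j = if i = j then (1 : ℝ) else 0)
  (T : J → UT N → Cp → Cp → ℝ) (hT : ∀ l x i i', ∑ k, T l x k i * T l x k i' = if i = i' then (1 : ℝ) else 0)
  (a : J → ℝ) (ha : ∀ j, 0 ≤ a j) (ω : J → UT N → ℝ)
  (hsupp : ∀ l x, ω l (ctrU N (S l) (tblk (hS l) (hdivS l) x)) ≠ 0 → ∃ k v, lvl k = l ∧ cellPt S hS hdivS lvl zc k v = x)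
  {amax : ℝ} (hamax : 0 ≤ amax)
  (hscale : ∀ k, a (lvl k) * ω (lvl k) (ctrU N (S (lvl k)) (zc k)) ^ 2 * (S (lvl k) : ℝ) ^ d ≤ amax / (S (lvl k) : ℝ) ^ 2)
  (c : UT N × Fin d → ℝ) {cmax : ℝ} (hc : ∀ b, |c b| ≤ cmax) {C : ℝ}
  (hcoer : ∀ f : UT N × Cp → ℝ,
    C * ∑ k, ((S (lvl k) : ℝ) ^ 2)⁻¹ * ∑ v : Box d (S (lvl k)), ∑ i, f (cellPt S hS hdivS lvl zc k v, i) ^ 2 ≤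
      ∑ p, f p * levelOp bsrc btgt c Rm (fun l x => ctrU N (S l) (tblk (hS l) (hdivS l) x))
        (fun l x => ω l (ctrU N (S l) (tblk (hS l) (hdivS l) x))) T a f p)
  {κ : ℝ} (hκ0 : 0 ≤ κ) (hκ1 : κ ≤ 1) (hμ : 0 < C - 2 * d * cmax ^ 2 * κ ^ 2 - amax * (Real.exp (2 * d * κ) - 1))
  {L : ℕ} (hL : 1 ≤ L) (e : J → ℕ) (hSe : ∀ l, S l = L ^ e l) {R : ℝ} (hR : 0 < R) {A : ℕ}
  (hadd : ∀ x y : UT N, |(e (lvl (cellOf S hS hdivS lvl zc hcover x)) : ℝ) - e (lvl (cellOf S hS hdivS lvl zc hcover y))| ≤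
    A + sdist bsrc btgt (siteScale S hS hdivS lvl zc hcover) x y / R)
  (hrate1 : Real.log L / R ≤ κ)

/-! ## §1 The ℓ²-cell form of the averaging budget and the Laplacian split -/

include hdisj hT ha hsupp hamax hscale in
omit [NeZero d] [Fintype K] in
/-- **ℓ²-cell form of file 10a**: `Σ_{cell k″}((Σ_l a_lG_lᵀG_l)f)² ≤ |Cp|·a_max²·S_{k″}^{−4}·Σ_{cell k″} f²`. [folklore] -/
theorem cell_sq_levelSum_le (f : UT N × Cp → ℝ) (k'' : K) :
    ∑ p ∈ univ.filter (fun p : UT N × Cp => cellOf S hS hdivS lvl zc hcover p.1 = k''),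
        (levelSum (fun l x => ctrU N (S l) (tblk (hS l) (hdivS l) x)) (fun l x => ω l (ctrU N (S l) (tblk (hS l) (hdivS l) x))) T a f p) ^ 2 ≤
      Fintype.card Cp * amax ^ 2 * (((S (lvl k'') : ℝ)) ^ 4)⁻¹ *
        ∑ p ∈ univ.filter (fun p : UT N × Cp => cellOf S hS hdivS lvl zc hcover p.1 = k''), f p ^ 2 := by
  classical
  set F := univ.filter (fun p : UT N × Cp => cellOf S hS hdivS lvl zc hcover p.1 = k'') with hF
  set X : ℝ := ∑ p ∈ F, f p ^ 2 with hX
  set s : ℝ := (S (lvl k'') : ℝ) with hs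
  have hs0 : 0 < s := by rw [hs]; exact_mod_cast hS (lvl k'')
  have hX0 : 0 ≤ X := Finset.sum_nonneg fun p _ => sq_nonneg _
  have hpt : ∀ p ∈ F, (levelSum (fun l x => ctrU N (S l) (tblk (hS l) (hdivS l) x))
      (fun l x => ω l (ctrU N (S l) (tblk (hS l) (hdivS l) x))) T a f p) ^ 2 ≤ amax ^ 2 * (s ^ 2)⁻¹ ^ 2 * ((s ^ d)⁻¹ * X) := by
    intro p hp
    have h := abs_levelSum_apply_le S hS hdivS lvl zc hdisj hcover T hT a ha ω hsupp hamax hscale f p k'' (mem_filter.mp hp).2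
    rw [← hs, ← hF, ← hX] at h
    have h0 : 0 ≤ amax * (s ^ 2)⁻¹ * Real.sqrt ((s ^ d)⁻¹ * X) := by positivity
    have h2 := pow_le_pow_left₀ (abs_nonneg _) h 2
    rw [sq_abs, mul_pow, mul_pow, Real.sq_sqrt (by positivity)] at h2
    exact h2
  have hcard : (F.card : ℝ) ≤ s ^ d * Fintype.card Cp := by
    rw [hs]; exact_mod_cast card_cellCp_le S hS hdivS lvl zc hcover k''
  calc ∑ p ∈ F, (levelSum (fun l x => ctrU N (S l) (tblk (hS l) (hdivS l) x))
        (fun l x => ω l (ctrU N (S l) (tblk (hS l) (hdivS l) x))) T a f p) ^ 2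
      ≤ ∑ p ∈ F, amax ^ 2 * (s ^ 2)⁻¹ ^ 2 * ((s ^ d)⁻¹ * X) := Finset.sum_le_sum hpt
    _ = F.card * (amax ^ 2 * (s ^ 2)⁻¹ ^ 2 * ((s ^ d)⁻¹ * X)) := by rw [Finset.sum_const, nsmul_eq_mul]
    _ ≤ (s ^ d * Fintype.card Cp) * (amax ^ 2 * (s ^ 2)⁻¹ ^ 2 * ((s ^ d)⁻¹ * X)) :=
        mul_le_mul_of_nonneg_right hcard (by positivity)
    _ = Fintype.card Cp * amax ^ 2 * (s ^ 4)⁻¹ * X := by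
        field_simp

include hdisj hcover hRm hT ha hsupp hamax hscale hc hcoer hκ0 hκ1 hμ in
omit [DecidableEq K] in
/-- **The Laplacian split**: `D*D(levelOp)⁻¹u = u − (Σ_l a_lG_lᵀG_l)(levelOp)⁻¹u` (`levelOp = D*D + Σ_l a_lG_lᵀG_l` and `levelOp` is a unit
under the margin `μ₀ > 0`). [cite: Balaban1985BackgroundPropagators, (3.16) p.393 + (3.24) p.394] [folklore] -/
theorem covLap_eq_sub_levelSum (u : UT N × Cp → ℝ) (p : UT N × Cp) :
    covDT bsrc btgt c Rm (covD bsrc btgt c Rm ((Ring.inverse (levelOp bsrc btgt c Rm (fun l x => ctrU N (S l) (tblk (hS l) (hdivS l) x))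
        (fun l x => ω l (ctrU N (S l) (tblk (hS l) (hdivS l) x))) T a)) u)) p =
      u p - levelSum (fun l x => ctrU N (S l) (tblk (hS l) (hdivS l) x)) (fun l x => ω l (ctrU N (S l) (tblk (hS l) (hdivS l) x))) T a
        ((Ring.inverse (levelOp bsrc btgt c Rm (fun l x => ctrU N (S l) (tblk (hS l) (hdivS l) x))
          (fun l x => ω l (ctrU N (S l) (tblk (hS l) (hdivS l) x))) T a)) u) p := by
  obtain ⟨i₀⟩ := ‹Nonempty Cp›
  set Aop := levelOp bsrc btgt c Rm (fun l x => ctrU N (S l) (tblk (hS l) (hdivS l) x))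
    (fun l x => ω l (ctrU N (S l) (tblk (hS l) (hdivS l) x))) T a with hAop
  set w := (Ring.inverse Aop) u with hw
  have hunit : IsUnit Aop :=
    (decay_levelOp S hS hdivS lvl zc hdisj hcover Rm hRm T hT a ha ω hsupp hamax hscale c hc hcoer hκ0 hκ1 hμ (p.1, i₀) (p.1, i₀)).1
  have hAw : Aop w = u := by
    rw [hw, ← Module.End.mul_apply, Ring.mul_inverse_cancel _ hunit, Module.End.one_apply]
  have happ : Aop w p = covDT bsrc btgt c Rm (covD bsrc btgt c Rm w) p +
      levelSum (fun l x => ctrU N (S l) (tblk (hS l) (hdivS l) x)) (fun l x => ω l (ctrU N (S l) (tblk (hS l) (hdivS l) x))) T a w p := by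
    rw [hAop, levelOp]; rfl
  rw [hAw] at happ
  linarith

/-! ## §2 The three cellwise inputs on a near cell, in the currency `E²·Σ_{cell k′}u²` -/

include hdisj hRm hT ha hsupp hamax hscale hc hcoer hκ0 hκ1 hμ hL hSe hR hadd hrate1

/-- **(3.46)₁ on a near cell**: `d_n(t_{k″},t_k) ≤ 4d+ρ₀` ⟹
`Σ_{cell k″} w² ≤ (L^A e^{4dκ}Γ₄²S_k²/μ₀)²·E²·Σ_{cell k′}u²`, `Γ₄ = L^A e^{(log L/R)(4d+ρ₀)}`,
`E = e^{(κ−log L/R)(4d+ρ₀)}·e^{−(κ−log L/R)d_n(t_k,t_{k′})}`. [cite: Balaban1985BackgroundPropagators, Thm 3.1 (3.46) p.398] [folklore] -/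
theorem cell_sq_norm_le_near (ρ₀ : ℕ) (k' : K) (u : UT N × Cp → ℝ) (hu : ∀ p, cellOf S hS hdivS lvl zc hcover p.1 ≠ k' → u p = 0)
    (k k'' : K) (hnear : sdist bsrc btgt (siteScale S hS hdivS lvl zc hcover) (ctrU N (S (lvl k'')) (zc k'')) (ctrU N (S (lvl k)) (zc k)) ≤
      4 * d + ρ₀) :
    ∑ p ∈ univ.filter (fun p : UT N × Cp => cellOf S hS hdivS lvl zc hcover p.1 = k''),
        (Ring.inverse (levelOp bsrc btgt c Rm (fun l x => ctrU N (S l) (tblk (hS l) (hdivS l) x))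
          (fun l x => ω l (ctrU N (S l) (tblk (hS l) (hdivS l) x))) T a)) u p ^ 2 ≤
      ((L : ℝ) ^ A * Real.exp (4 * d * κ) * ((L : ℝ) ^ A * Real.exp (Real.log L / R * (4 * d + ρ₀))) ^ 2 * (S (lvl k) : ℝ) ^ 2 /
          (C - 2 * d * cmax ^ 2 * κ ^ 2 - amax * (Real.exp (2 * d * κ) - 1))) ^ 2 *
        (Real.exp ((κ - Real.log L / R) * (4 * d + ρ₀)) *
          Real.exp (-((κ - Real.log L / R) * sdist bsrc btgt (siteScale S hS hdivS lvl zc hcover)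
            (ctrU N (S (lvl k)) (zc k)) (ctrU N (S (lvl k')) (zc k'))))) ^ 2 *
        ∑ q ∈ univ.filter (fun q : UT N × Cp => cellOf S hS hdivS lvl zc hcover q.1 = k'), u q ^ 2 := by
  -- the cell of a centre is its cell; the additive datum at a pair of centres
  have hkc : ∀ k₁ : K, cellOf S hS hdivS lvl zc hcover (ctrU N (S (lvl k₁)) (zc k₁)) = k₁ := fun k₁ => by
    rw [← cubePt_zero (hS (lvl k₁)) (hdivS (lvl k₁)) (zc k₁)]; exact cellOf_cellPt S hS hdivS lvl zc hdisj hcover k₁ _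
  have haddc : |(e (lvl k'') : ℝ) - e (lvl k')| ≤ A + sdist bsrc btgt (siteScale S hS hdivS lvl zc hcover)
      (ctrU N (S (lvl k'')) (zc k'')) (ctrU N (S (lvl k')) (zc k')) / R := by
    have h := hadd (ctrU N (S (lvl k'')) (zc k'')) (ctrU N (S (lvl k')) (zc k')); rwa [hkc, hkc] at h
  have h8 := real_cellNorm_levelOp_inverse_le_graded S hS hdivS lvl zc hdisj hcover Rm hRm T hT a ha ω hsupp hamax hscale c hc hcoer hκ0 hκ1
    hμ hL e hSe k'' k' haddc u hu
  -- abbreviations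
  set μ₀ := C - 2 * d * cmax ^ 2 * κ ^ 2 - amax * (Real.exp (2 * d * κ) - 1) with hμ₀
  set n := siteScale S hS hdivS lvl zc hcover with hn
  set κ₁ : ℝ := κ - Real.log L / R with hκ₁
  set Γ₄ : ℝ := (L : ℝ) ^ A * Real.exp (Real.log L / R * (4 * d + ρ₀)) with hΓ₄
  set D0 : ℝ := sdist bsrc btgt n (ctrU N (S (lvl k)) (zc k)) (ctrU N (S (lvl k')) (zc k')) with hD0
  set E : ℝ := Real.exp (κ₁ * (4 * d + ρ₀)) * Real.exp (-(κ₁ * D0)) with hE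
  set X : ℝ := ∑ p ∈ univ.filter (fun p : UT N × Cp => cellOf S hS hdivS lvl zc hcover p.1 = k''),
    (Ring.inverse (levelOp bsrc btgt c Rm (fun l x => ctrU N (S l) (tblk (hS l) (hdivS l) x))
      (fun l x => ω l (ctrU N (S l) (tblk (hS l) (hdivS l) x))) T a)) u p ^ 2 with hX
  set U2 : ℝ := ∑ q ∈ univ.filter (fun q : UT N × Cp => cellOf S hS hdivS lvl zc hcover q.1 = k'), u q ^ 2 with hU2
  have hX0 : 0 ≤ X := Finset.sum_nonneg fun p _ => sq_nonneg _
  have hU20 : 0 ≤ U2 := Finset.sum_nonneg fun p _ => sq_nonneg _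
  have hκ₁0 : 0 ≤ κ₁ := by rw [hκ₁]; linarith
  -- scale and decay transfers
  have hsc := (scale_cmp_of_near S hS hdivS lvl zc hdisj hcover hL e hSe hR hadd k k'' hnear).1
  have hdec := exp_decay_transfer S hS hdivS lvl zc hcover hκ₁0 k k' k'' hnear
  rw [← hn] at hdec
  -- the member, squared
  have hmem : Real.sqrt X ≤ (L : ℝ) ^ A * Real.exp (4 * d * κ) * ((S (lvl k'') : ℝ) ^ 2 / μ₀) *
      Real.exp (-(κ₁ * sdist bsrc btgt n (ctrU N (S (lvl k'')) (zc k'')) (ctrU N (S (lvl k')) (zc k')))) * Real.sqrt U2 := by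
    simpa only [hX, hU2, hn, hκ₁, hμ₀] using h8
  have hB0 : 0 ≤ (L : ℝ) ^ A * Real.exp (4 * d * κ) * (Γ₄ ^ 2 * (S (lvl k) : ℝ) ^ 2 / μ₀) * E := by positivity
  have hmem' : Real.sqrt X ≤ (L : ℝ) ^ A * Real.exp (4 * d * κ) * (Γ₄ ^ 2 * (S (lvl k) : ℝ) ^ 2 / μ₀) * E * Real.sqrt U2 := by
    refine hmem.trans (mul_le_mul_of_nonneg_right ?_ (Real.sqrt_nonneg _))
    have h1 : ((S (lvl k'') : ℝ)) ^ 2 ≤ Γ₄ ^ 2 * (S (lvl k) : ℝ) ^ 2 := by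
      rw [← mul_pow]; exact pow_le_pow_left₀ (Nat.cast_nonneg _) hsc 2
    have h2 : ((S (lvl k'') : ℝ)) ^ 2 / μ₀ ≤ Γ₄ ^ 2 * (S (lvl k) : ℝ) ^ 2 / μ₀ := div_le_div_of_nonneg_right h1 hμ.le
    have hpre : 0 ≤ (L : ℝ) ^ A * Real.exp (4 * d * κ) := by positivity
    exact mul_le_mul (mul_le_mul_of_nonneg_left h2 hpre) hdec (Real.exp_pos _).le (by positivity)
  -- square
  have hsq : X ≤ ((L : ℝ) ^ A * Real.exp (4 * d * κ) * (Γ₄ ^ 2 * (S (lvl k) : ℝ) ^ 2 / μ₀) * E * Real.sqrt U2) ^ 2 := by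
    rw [← Real.sq_sqrt hX0]; exact pow_le_pow_left₀ (Real.sqrt_nonneg _) hmem' 2
  rw [mul_pow, Real.sq_sqrt hU20] at hsq
  calc X ≤ ((L : ℝ) ^ A * Real.exp (4 * d * κ) * (Γ₄ ^ 2 * (S (lvl k) : ℝ) ^ 2 / μ₀) * E) ^ 2 * U2 := hsq
    _ = _ := by simp only [hΓ₄, hE, hκ₁, hμ₀, hD0]; ring

/-- **(3.46)₂ on a near cell**: `Σ_{b₋ ∈ cell k″}Σ_i(Dw)² ≤ (√(2(C+de²c_max²))·L^A·Γ₄·S_k·e^{4dκ}/μ₀)²·E²·Σ_{cell k′}u²`.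
[cite: Balaban1985BackgroundPropagators, Thm 3.1 (3.46) p.398] [folklore] -/
theorem cell_sq_grad_le_near (ρ₀ : ℕ) (k' : K) (u : UT N × Cp → ℝ) (hu : ∀ p, cellOf S hS hdivS lvl zc hcover p.1 ≠ k' → u p = 0)
    (k k'' : K) (hnear : sdist bsrc btgt (siteScale S hS hdivS lvl zc hcover) (ctrU N (S (lvl k'')) (zc k'')) (ctrU N (S (lvl k)) (zc k)) ≤
      4 * d + ρ₀) :
    ∑ b ∈ univ.filter (fun b : UT N × Fin d => cellOf S hS hdivS lvl zc hcover (bsrc b) = k''),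
        ∑ i, (covD bsrc btgt c Rm ((Ring.inverse (levelOp bsrc btgt c Rm (fun l x => ctrU N (S l) (tblk (hS l) (hdivS l) x))
          (fun l x => ω l (ctrU N (S l) (tblk (hS l) (hdivS l) x))) T a)) u) (b, i)) ^ 2 ≤
      (Real.sqrt (2 * (C + d * Real.exp 1 ^ 2 * cmax ^ 2)) * (L : ℝ) ^ A * ((L : ℝ) ^ A * Real.exp (Real.log L / R * (4 * d + ρ₀))) *
          (S (lvl k) : ℝ) / (C - 2 * d * cmax ^ 2 * κ ^ 2 - amax * (Real.exp (2 * d * κ) - 1)) * Real.exp (4 * d * κ)) ^ 2 *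
        (Real.exp ((κ - Real.log L / R) * (4 * d + ρ₀)) *
          Real.exp (-((κ - Real.log L / R) * sdist bsrc btgt (siteScale S hS hdivS lvl zc hcover)
            (ctrU N (S (lvl k)) (zc k)) (ctrU N (S (lvl k')) (zc k'))))) ^ 2 *
        ∑ q ∈ univ.filter (fun q : UT N × Cp => cellOf S hS hdivS lvl zc hcover q.1 = k'), u q ^ 2 := by
  have h20 := real_cellGrad_levelOp_inverse_le_graded S hS hdivS lvl zc hdisj hcover Rm hRm T hT a ha ω hsupp hamax hscale c hc hcoer hκ0
    hκ1 hμ hL e hSe hadd k' u hu k''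
  set μ₀ := C - 2 * d * cmax ^ 2 * κ ^ 2 - amax * (Real.exp (2 * d * κ) - 1) with hμ₀
  set n := siteScale S hS hdivS lvl zc hcover with hn
  set κ₁ : ℝ := κ - Real.log L / R with hκ₁
  set Γ₄ : ℝ := (L : ℝ) ^ A * Real.exp (Real.log L / R * (4 * d + ρ₀)) with hΓ₄
  set D0 : ℝ := sdist bsrc btgt n (ctrU N (S (lvl k)) (zc k)) (ctrU N (S (lvl k')) (zc k')) with hD0
  set E : ℝ := Real.exp (κ₁ * (4 * d + ρ₀)) * Real.exp (-(κ₁ * D0)) with hE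
  set Ke : ℝ := Real.sqrt (2 * (C + d * Real.exp 1 ^ 2 * cmax ^ 2)) with hKe
  set X : ℝ := ∑ b ∈ univ.filter (fun b : UT N × Fin d => cellOf S hS hdivS lvl zc hcover (bsrc b) = k''),
    ∑ i, (covD bsrc btgt c Rm ((Ring.inverse (levelOp bsrc btgt c Rm (fun l x => ctrU N (S l) (tblk (hS l) (hdivS l) x))
      (fun l x => ω l (ctrU N (S l) (tblk (hS l) (hdivS l) x))) T a)) u) (b, i)) ^ 2 with hX
  set U2 : ℝ := ∑ q ∈ univ.filter (fun q : UT N × Cp => cellOf S hS hdivS lvl zc hcover q.1 = k'), u q ^ 2 with hU2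
  have hX0 : 0 ≤ X := Finset.sum_nonneg fun b _ => Finset.sum_nonneg fun i _ => sq_nonneg _
  have hU20 : 0 ≤ U2 := Finset.sum_nonneg fun p _ => sq_nonneg _
  have hκ₁0 : 0 ≤ κ₁ := by rw [hκ₁]; linarith
  have hsc := (scale_cmp_of_near S hS hdivS lvl zc hdisj hcover hL e hSe hR hadd k k'' hnear).1
  have hdec := exp_decay_transfer S hS hdivS lvl zc hcover hκ₁0 k k' k'' hnear
  rw [← hn] at hdec
  have hmem : Real.sqrt X ≤ Ke * (L : ℝ) ^ A * ((S (lvl k'') : ℝ) / μ₀) * Real.exp (4 * d * κ) *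
      Real.exp (-(κ₁ * sdist bsrc btgt n (ctrU N (S (lvl k'')) (zc k'')) (ctrU N (S (lvl k')) (zc k')))) * Real.sqrt U2 := by
    simpa only [hX, hU2, hn, hκ₁, hμ₀, hKe] using h20
  have hKe0 : 0 ≤ Ke := Real.sqrt_nonneg _
  have hmem' : Real.sqrt X ≤ Ke * (L : ℝ) ^ A * (Γ₄ * (S (lvl k) : ℝ) / μ₀) * Real.exp (4 * d * κ) * E * Real.sqrt U2 := by
    refine hmem.trans (mul_le_mul_of_nonneg_right ?_ (Real.sqrt_nonneg _))
    have h2 : ((S (lvl k'') : ℝ)) / μ₀ ≤ Γ₄ * (S (lvl k) : ℝ) / μ₀ := div_le_div_of_nonneg_right hsc hμ.le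
    have hpre : 0 ≤ Ke * (L : ℝ) ^ A := by positivity
    exact mul_le_mul (mul_le_mul_of_nonneg_right (mul_le_mul_of_nonneg_left h2 hpre) (Real.exp_pos _).le) hdec
      (Real.exp_pos _).le (by positivity)
  have hsq : X ≤ (Ke * (L : ℝ) ^ A * (Γ₄ * (S (lvl k) : ℝ) / μ₀) * Real.exp (4 * d * κ) * E * Real.sqrt U2) ^ 2 := by
    rw [← Real.sq_sqrt hX0]; exact pow_le_pow_left₀ (Real.sqrt_nonneg _) hmem' 2
  rw [mul_pow, Real.sq_sqrt hU20] at hsq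
  calc X ≤ (Ke * (L : ℝ) ^ A * (Γ₄ * (S (lvl k) : ℝ) / μ₀) * Real.exp (4 * d * κ) * E) ^ 2 * U2 := hsq
    _ = _ := by simp only [hΓ₄, hE, hκ₁, hμ₀, hKe, hD0]; ring

omit hR in
/-- **The Laplacian on a near cell — SCALE-FREE**: `Σ_{cell k″}(D*Dw)² ≤ 2(1 + |Cp|a_max²(L^Ae^{4dκ}/μ₀)²)·E²·Σ_{cell k′}u²` (the `u`-term
lives on `k″ = k′` only, where `E ≥ 1`; the averaging term's `S_{k″}^{−4}` cancels (3.46)₁'s `S_{k″}⁴`).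
[cite: Balaban1985BackgroundPropagators, Thm 3.1 (3.42)₄∕(3.46) pp.397–398 + (3.24) p.394] [folklore] -/
theorem cell_sq_lap_le_near (ρ₀ : ℕ) (k' : K) (u : UT N × Cp → ℝ) (hu : ∀ p, cellOf S hS hdivS lvl zc hcover p.1 ≠ k' → u p = 0)
    (k k'' : K) (hnear : sdist bsrc btgt (siteScale S hS hdivS lvl zc hcover) (ctrU N (S (lvl k'')) (zc k'')) (ctrU N (S (lvl k)) (zc k)) ≤
      4 * d + ρ₀) :
    ∑ p ∈ univ.filter (fun p : UT N × Cp => cellOf S hS hdivS lvl zc hcover p.1 = k''),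
        (covDT bsrc btgt c Rm (covD bsrc btgt c Rm ((Ring.inverse (levelOp bsrc btgt c Rm (fun l x => ctrU N (S l) (tblk (hS l) (hdivS l) x))
          (fun l x => ω l (ctrU N (S l) (tblk (hS l) (hdivS l) x))) T a)) u)) p) ^ 2 ≤
      2 * (1 + Fintype.card Cp * amax ^ 2 * ((L : ℝ) ^ A * Real.exp (4 * d * κ) /
          (C - 2 * d * cmax ^ 2 * κ ^ 2 - amax * (Real.exp (2 * d * κ) - 1))) ^ 2) *
        (Real.exp ((κ - Real.log L / R) * (4 * d + ρ₀)) *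
          Real.exp (-((κ - Real.log L / R) * sdist bsrc btgt (siteScale S hS hdivS lvl zc hcover)
            (ctrU N (S (lvl k)) (zc k)) (ctrU N (S (lvl k')) (zc k'))))) ^ 2 *
        ∑ q ∈ univ.filter (fun q : UT N × Cp => cellOf S hS hdivS lvl zc hcover q.1 = k'), u q ^ 2 := by
  classical
  have hkc : ∀ k₁ : K, cellOf S hS hdivS lvl zc hcover (ctrU N (S (lvl k₁)) (zc k₁)) = k₁ := fun k₁ => by
    rw [← cubePt_zero (hS (lvl k₁)) (hdivS (lvl k₁)) (zc k₁)]; exact cellOf_cellPt S hS hdivS lvl zc hdisj hcover k₁ _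
  have haddc : |(e (lvl k'') : ℝ) - e (lvl k')| ≤ A + sdist bsrc btgt (siteScale S hS hdivS lvl zc hcover)
      (ctrU N (S (lvl k'')) (zc k'')) (ctrU N (S (lvl k')) (zc k')) / R := by
    have h := hadd (ctrU N (S (lvl k'')) (zc k'')) (ctrU N (S (lvl k')) (zc k')); rwa [hkc, hkc] at h
  have h8 := real_cellNorm_levelOp_inverse_le_graded S hS hdivS lvl zc hdisj hcover Rm hRm T hT a ha ω hsupp hamax hscale c hc hcoer hκ0 hκ1
    hμ hL e hSe k'' k' haddc u hu
  set μ₀ := C - 2 * d * cmax ^ 2 * κ ^ 2 - amax * (Real.exp (2 * d * κ) - 1) with hμ₀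
  set Aop := levelOp bsrc btgt c Rm (fun l x => ctrU N (S l) (tblk (hS l) (hdivS l) x))
    (fun l x => ω l (ctrU N (S l) (tblk (hS l) (hdivS l) x))) T a with hAop
  set Pop := levelSum (fun l x => ctrU N (S l) (tblk (hS l) (hdivS l) x))
    (fun l x => ω l (ctrU N (S l) (tblk (hS l) (hdivS l) x))) T a with hPop
  set n := siteScale S hS hdivS lvl zc hcover with hn
  set κ₁ : ℝ := κ - Real.log L / R with hκ₁
  set D0 : ℝ := sdist bsrc btgt n (ctrU N (S (lvl k)) (zc k)) (ctrU N (S (lvl k')) (zc k')) with hD0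
  set E : ℝ := Real.exp (κ₁ * (4 * d + ρ₀)) * Real.exp (-(κ₁ * D0)) with hE
  set w := (Ring.inverse Aop) u with hw
  set F := univ.filter (fun p : UT N × Cp => cellOf S hS hdivS lvl zc hcover p.1 = k'') with hF
  set U2 : ℝ := ∑ q ∈ univ.filter (fun q : UT N × Cp => cellOf S hS hdivS lvl zc hcover q.1 = k'), u q ^ 2 with hU2
  set Xw : ℝ := ∑ p ∈ F, w p ^ 2 with hXw
  set s'' : ℝ := (S (lvl k'') : ℝ) with hs''
  have hs0 : 0 < s'' := by rw [hs'']; exact_mod_cast hS (lvl k'')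
  have hU20 : 0 ≤ U2 := Finset.sum_nonneg fun p _ => sq_nonneg _
  have hXw0 : 0 ≤ Xw := Finset.sum_nonneg fun p _ => sq_nonneg _
  have hκ₁0 : 0 ≤ κ₁ := by rw [hκ₁]; linarith
  have hdec := exp_decay_transfer S hS hdivS lvl zc hcover hκ₁0 k k' k'' hnear
  rw [← hn] at hdec
  -- the `u`-term: `Σ_{cell k″} u² ≤ E²·U2`
  have hE1 : k'' = k' → 1 ≤ E := by
    intro hkk
    rw [hE, ← Real.exp_add]
    refine Real.one_le_exp_iff.mpr ?_
    have hD : D0 ≤ 4 * d + ρ₀ := by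
      rw [hD0, sdist_comm bsrc btgt n, ← hkk]; simpa only [hn] using hnear
    nlinarith
  have hu_term : ∑ p ∈ F, u p ^ 2 ≤ E ^ 2 * U2 := by
    by_cases hkk : k'' = k'
    · have h1 := hE1 hkk
      rw [hF, hkk, ← hU2]
      have h2 : (1 : ℝ) ≤ E ^ 2 := one_le_pow₀ h1
      nlinarith
    · have h0 : ∑ p ∈ F, u p ^ 2 = 0 := Finset.sum_eq_zero fun p hp => by
        rw [hu p (by rw [(mem_filter.mp hp).2]; exact hkk)]; ring
      rw [h0]; positivity
  -- the averaging term
  have havg := cell_sq_levelSum_le S hS hdivS lvl zc hdisj hcover T hT a ha ω hsupp hamax hscale w k''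
  rw [← hPop, ← hF, ← hXw] at havg
  have hmem : Real.sqrt Xw ≤ (L : ℝ) ^ A * Real.exp (4 * d * κ) * (s'' ^ 2 / μ₀) *
      Real.exp (-(κ₁ * sdist bsrc btgt n (ctrU N (S (lvl k'')) (zc k'')) (ctrU N (S (lvl k')) (zc k')))) * Real.sqrt U2 := by
    simpa only [hXw, hU2, hn, hκ₁, hμ₀, hF, hw, hAop, hs''] using h8
  have hmem' : Real.sqrt Xw ≤ (L : ℝ) ^ A * Real.exp (4 * d * κ) * (s'' ^ 2 / μ₀) * E * Real.sqrt U2 :=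
    hmem.trans (mul_le_mul_of_nonneg_right (mul_le_mul_of_nonneg_left hdec (by positivity)) (Real.sqrt_nonneg _))
  have hXw_le : Xw ≤ ((L : ℝ) ^ A * Real.exp (4 * d * κ) * (s'' ^ 2 / μ₀) * E) ^ 2 * U2 := by
    have hsq : Xw ≤ ((L : ℝ) ^ A * Real.exp (4 * d * κ) * (s'' ^ 2 / μ₀) * E * Real.sqrt U2) ^ 2 := by
      rw [← Real.sq_sqrt hXw0]; exact pow_le_pow_left₀ (Real.sqrt_nonneg _) hmem' 2
    rwa [mul_pow, Real.sq_sqrt hU20] at hsq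
  have havg' : ∑ p ∈ F, Pop w p ^ 2 ≤ Fintype.card Cp * amax ^ 2 * ((L : ℝ) ^ A * Real.exp (4 * d * κ) / μ₀) ^ 2 * (E ^ 2 * U2) := by
    calc ∑ p ∈ F, Pop w p ^ 2 ≤ Fintype.card Cp * amax ^ 2 * (s'' ^ 4)⁻¹ * Xw := havg
      _ ≤ Fintype.card Cp * amax ^ 2 * (s'' ^ 4)⁻¹ * (((L : ℝ) ^ A * Real.exp (4 * d * κ) * (s'' ^ 2 / μ₀) * E) ^ 2 * U2) :=
          mul_le_mul_of_nonneg_left hXw_le (by positivity)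
      _ = Fintype.card Cp * amax ^ 2 * ((L : ℝ) ^ A * Real.exp (4 * d * κ) / μ₀) ^ 2 * (E ^ 2 * U2) := by
          field_simp
  -- pointwise split and `(u − P)² ≤ 2u² + 2P²`
  have hsplit : ∀ p, covDT bsrc btgt c Rm (covD bsrc btgt c Rm w) p = u p - Pop w p := fun p => by
    have h := covLap_eq_sub_levelSum S hS hdivS lvl zc hdisj hcover Rm hRm T hT a ha ω hsupp hamax hscale c hc hcoer hκ0 hκ1 hμ u p
    simpa only [hw, hAop, hPop] using h
  calc ∑ p ∈ F, (covDT bsrc btgt c Rm (covD bsrc btgt c Rm w) p) ^ 2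
      ≤ ∑ p ∈ F, (2 * u p ^ 2 + 2 * Pop w p ^ 2) := Finset.sum_le_sum fun p _ => by
        rw [hsplit p]; nlinarith [sq_nonneg (u p + Pop w p)]
    _ = 2 * ∑ p ∈ F, u p ^ 2 + 2 * ∑ p ∈ F, Pop w p ^ 2 := by rw [Finset.sum_add_distrib, Finset.mul_sum, Finset.mul_sum]
    _ ≤ 2 * (E ^ 2 * U2) + 2 * (Fintype.card Cp * amax ^ 2 * ((L : ℝ) ^ A * Real.exp (4 * d * κ) / μ₀) ^ 2 * (E ^ 2 * U2)) := by
        linarith [hu_term, havg']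
    _ = _ := by simp only [hE, hκ₁, hμ₀, hU2, hD0]; ring

end

end Summit.QuantumFields.BalabanUV.Beta.MultiscaleHessianCells
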